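import Summits.QuantumFields.BalabanUV.T4Continuum.Support.NE7ApeCurvedRepRoadBBalabanEnd
import Summits.QuantumFields.BalabanUV.T4Continuum.Support.NE7BalabanGaugeTransportRows
import HarnessLib

/-!
# NE7ApeCurvedRepRoadBBlockLandauEnd — THE END OF RECORD AFTER GEN 83, ROW FORM: the curved (APE) with a datum on road (B) ⇐ E′ regime + class data + regime lines +
# (L1)′ names + THREE SUP ROWS OF BAŁABAN's OPERATORS AT THE CURVED BACKGROUND — **(KL-B)** the curl row of the constrained 1-form propagator on `ker QbarIter_W` in the
# block-Landau gauge ([B9] Thm 3.1–3.3∕(3.49)∕3.11 TYPE; source form F173), **(R-H)** the sup row of the scalar minimal extension (harmonic, prescribed nested block means),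
# **(R-C)** the sup row of the block-mean-zero constrained scalar propagator (block-Landau correction; existence F172) — no smoothness letter, no transport letter, no four-term
# letter left displayed (file 105 of the curved (APE), F175)

Cell `pub-balaban`, rung (B)+1 sub-cell t4, lineage `b2b-balaban-t4-ne7-p1` (CRUX PROVER NE7 #1 = OWNER of row NE7), generation 83; memo
`t4/b2b-balaban-t4-ne7-p1-g83/BALABAN-GAUGE-ROAD.md` §8.  Over F169 `NE7ApeCurvedRepRoadBBalabanEnd` and F174 `NE7BalabanGaugeTransportRows` BY NAME (pure composition).
WHY.  F171 displayed (T1) (a smooth right inverse) + (T2); F174 shows the smoothness is spurious once `Gauge` IS Bałaban's block-Landau condition: the moved field is canonical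
(`σ + h + c`), and its size is two scalar sup rows.  So the END's three letters are now rows of THE SAME family of operators [B9] §3 estimates — the vector propagator
`G(U)` ∕ `(QGQ^*)⁻¹` (Thm 3.1–3.3, (3.49)) and the scalar ones behind the gauge fixing — at a background of the class: one docking target for NE9's tree (P3), or one bootstrap
(P2′) with the Campanato kit.
WHAT ([folklore]; 0 def, 0 sorry).  **`smallField_of_tanCritical_roadB_blockLandau_end`** — F169's conclusion at the block-Landau `Gauge` with `C_R = 6dC_H·L^{j+1}`,
`C_Ξ = 1 + C_H`, `C_D = C_b`.  PRICING (power counting, not kernel): `K_B ≍ K₁M`, `C_H ≍ 1`, `C_b ≍ M²` ⟹ `K_X ≍ (b + K₁c)∕M`, `K_D ≍ b + K₁c`, `K_Ξ ≍ (b + K₁c)∕M²`.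
HONEST FRAMING (page 1): composition; (KL-B), (R-H), (R-C)'s size are HYPOTHESIS SHAPES at curved `W` (NOT proved); the END's own two crude kinematic prices (`2d·a_N`,
the pointing correction — gen 82 memo O2) stand; nothing of Bałaban's asserted; (APE) on curved data NOT proved; NOT ONE-STEP, NOT NE7; spine 0∕9; finite T⁴ rung (B)+1 —
NOT infinite volume, NOT mass gap, NOT `BetaPertH`, NOT Clay.  Continuum YM on T⁴ ⇐ BetaPertH ∧ nine spine estimates (0/9 proved); BetaPertH ⇐ (D1) ∧ (D4) ∧ CAP+tail;
G-an2-4 gates asym, D1 and NE2/3/4.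
-/

set_option autoImplicit false

open scoped BigOperators Matrix Matrix.Norms.L2Operator
open NormedSpace Finset

namespace Summit.QuantumFields.BalabanUV.T4Continuum.NE7ApeCurvedRepRoadBBlockLandauEnd

open Literature.MathematicalPhysics.QuantumFieldTheory.Balaban1983to89
open B7Prop1Explicit B7Prop2Explicit MatrixLog UnitaryModel
open T4AveragingDeficitWall (Ad IsUnitaryCfg IsSkewDir SmallField vary curlAt dirL1 flux covGrad)
open T4AveragingDeficitWallBoundary (IsPeriodicCfg periodBox)
open AveragingDeficitPeriodicCounting (IsPeriodicDir)
open AveragingDeficitTwoLevelPrep (twoLevelSmall)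
open AveragingDeficitMultiLevelPrep (cavgIter LevelSmall)
open MinimalActionLevels (perWin)
open BlockAverageVaryHolo (nbRad)
open BlockAveragePushDirGauge (gaugeDir)
open NE3HessForm (hess dAction)
open NE3TangentCovariantTower (dirIter QbarIter)
open NE3EnergyShapes (IsUnitarySite IsPeriodicSite)
open NE3CovariantWeitzenbock (covDiv)
open NE3RightInverseSupLetters (frameC supC corrC)
open NE3QbarIterCovLiftPrep (cruxC)
open NE3RightInverseSolveLetters (thetaLoc)
open NE3HatInvCurlLetters (curl1C)
open BlockAverageVaryDisc (rho0)
open NE3LinearisedAverageSup (curvSum)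
open NE7ApeCurvedRepRoadBBalabanEnd (smallField_of_tanCritical_roadB_balaban_end)
open NE7BalabanGaugeTransportRows (transportLetter_blockLandau_of_rows)
open NE3CovariantBlockMean (bmeanIterW)
open NE3CovariantCalculus (hsR)
open NE3.PairLandauB8 (avgKernelGauges)

open NE3.PairLandauB8 (IsLandauB8)

noncomputable section

variable {d : ℕ} {n : Type*} [Fintype n] [DecidableEq n]

/-- **THE CURVED (APE) WITH A DATUM ON (KL-B) + (R-H) + (R-C)** — every displayed letter a sup row of one of Bałaban's operators at the curved background `W`: F169
`smallField_of_tanCritical_roadB_balaban_end` at `Gauge :=` the block-Landau orthogonality, with its transport letter SUPPLIED by F174 `transportLetter_blockLandau_of_rows`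
(`C_R = 6dC_H·L^{j+1}`, `C_Ξ = 1 + C_H`, `C_D = C_b`). [folklore] -/
theorem smallField_of_tanCritical_roadB_blockLandau_end [Nonempty n] (hd : 2 ≤ d) {L N : ℕ} [NeZero N] (hL : 2 ≤ L) (j : ℕ)
    -- the background
    {W : Site d → Fin d → (Matrix n n ℂ)ˣ} {x : ℝ} (hWu : IsUnitaryCfg W) (hWP : IsPeriodicCfg W ((N * L ^ (j + 1) : ℕ) : ℤ))
    (hx : 0 ≤ x) (hs : LevelSmall d L j x) (hWx : SmallField W x)
    -- the sup radius of the representative and the regime at `x′ = x + 4(e^{α₀} − 1)`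
    {α₀ : ℝ} (hα0 : 0 ≤ α₀) (hs' : LevelSmall d L j (x + 4 * (Real.exp α₀ - 1)))
    (hθ : cruxC d L * (((L : ℝ) ^ (j + 1)) ^ 2 * (x + 4 * (Real.exp α₀ - 1))) < 1)
    (hθl : thetaLoc d L * (((L : ℝ) ^ (j + 1)) ^ 2 * (x + 4 * (Real.exp α₀ - 1))) < 1)
    (hε : ((L : ℝ) ^ (j + 1)) ^ 2 * (x + 4 * (Real.exp α₀ - 1)) ≤ 1)
    -- the field: of the class, tangent-critical, over `W`'s datum
    {U : Site d → Fin d → (Matrix n n ℂ)ˣ} (hUu : IsUnitaryCfg U) (hUP : IsPeriodicCfg U ((N * L ^ (j + 1) : ℕ) : ℤ))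
    {xU : ℝ} (hxU : 0 ≤ xU) (hsU : LevelSmall d L j xU) (hUxU : SmallField U xU)
    (hcritU : ∀ Y : Site d → Fin d → Matrix n n ℂ, IsSkewDir Y → IsPeriodicDir Y ((N * L ^ (j + 1) : ℕ) : ℤ) →
      dirIter L (j + 1) U Y = 0 → dAction U Y (perWin d (N * L ^ (j + 1))) = 0)
    (hTopUW : cavgIter L (j + 1) U = cavgIter L (j + 1) W)
    -- row NE3's class data of `W` and E′'s initial gauge ∕ regime (as in `exists_landauRep_W`), the constant `c_RE` named; road (B)'s two extra regime lines
    -- the FLUX-GRADIENT radii of `W` and `U` (row NE3's `RegularSup` datum; (1.8)∕(1.9) TYPE via `NE3FluxGradientDictionary` ∕ `MinimalActionClassSix`)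
    {gW gU : ℝ} (hgW : ∀ (z : Site d) (μ : Fin d) (π : T4AveragingDeficitWall.Plane d), ‖T4AveragingDeficitWall.covGrad W (T4AveragingDeficitWall.flux W) z μ π‖ ≤ gW)
    (hgU : ∀ (z : Site d) (μ : Fin d) (π : T4AveragingDeficitWall.Plane d), ‖T4AveragingDeficitWall.covGrad U (T4AveragingDeficitWall.flux U) z μ π‖ ≤ gU)
    (hbx : 23040 * (d : ℝ) ^ 4 * (frameC d L + d) ^ 2 * ((L : ℝ) ^ (j + 1)) ^ 2 * x ≤ 1)
    (hcx : 11520 * (d : ℝ) ^ 4 * (frameC d L + d) ^ 3 * ((L : ℝ) ^ (j + 1)) ^ 3 * (2 * gW) ≤ 1)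
    (hbx' : 256 * (d : ℝ) ^ 2 * ((L : ℝ) ^ (j + 1)) ^ 2 * x ≤ 1) (hcx' : 16 * (d : ℝ) * ((L : ℝ) ^ (j + 1)) ^ 3 * (2 * gW) ≤ 1)
    {r₀ b₀ : ℝ} (hr₀ : ∀ (y : Site d) (μ : Fin d), ‖(((W y μ)⁻¹ * U y μ : (Matrix n n ℂ)ˣ) : (Matrix n n ℂ)) - 1‖ ≤ r₀)
    (hb₀ : ∀ x : Site d, ‖covDiv W (fun y μ => mlog (((W y μ)⁻¹ * U y μ : (Matrix n n ℂ)ˣ) : (Matrix n n ℂ))) x‖ ≤ b₀)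
    {cRE : ℝ} (hcRE : cRE = 1 + 2 * (Fintype.card n : ℝ) * (64 * (d : ℝ) ^ 2 * N) ^ d + 27 * (Fintype.card n : ℝ) ^ 3 * (512 : ℝ) ^ d * (N : ℝ) ^ d)
    (hreg₁ : (36 * (d : ℝ) * (frameC d L + d) ^ 2) * ((L : ℝ) ^ (j + 1)) ^ 2 * (cRE * b₀) ≤ 1 / 10)
    (hreg₂ : (36 * (d : ℝ) * (frameC d L + d)) * (L : ℝ) ^ (j + 1) * (cRE * b₀) ≤ 1 / 25)
    (hreg₃ : r₀ + 5 / 2 * ((36 * (d : ℝ) * (frameC d L + d)) * (L : ℝ) ^ (j + 1) * (cRE * b₀)) ≤ 1 / 20)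
    (hline : cRE * (4 * ((36 * (d : ℝ) * (frameC d L + d) ^ 2) * ((L : ℝ) ^ (j + 1)) ^ 2) * (b₀ + 4 * (cRE * b₀))
        + 25 * d * (r₀ + 5 / 2 * ((36 * (d : ℝ) * (frameC d L + d)) * (L : ℝ) ^ (j + 1) * (cRE * b₀))) * ((36 * (d : ℝ) * (frameC d L + d)) * (L : ℝ) ^ (j + 1))
        + 14 * d * ((36 * (d : ℝ) * (frameC d L + d)) * (L : ℝ) ^ (j + 1)) ^ 2 * (cRE * b₀)) ≤ 1 / 2)
    -- E′'s radii named: `α_E`, `θ_u`; the tent extension's `δ = corrC∕M·2θ_u`; road (B)'s regime `α_E ≤ 1∕40`, `θ_u ≤ 1∕160`, `δ ≤ 1∕40`, `α₀ ≥ α_E + δ + 4(2θ_u+δ)(α_E+δ)`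
    {αE θu : ℝ} (hαE : αE = 2 * (r₀ + 5 / 2 * ((36 * (d : ℝ) * (frameC d L + d)) * (L : ℝ) ^ (j + 1) * (cRE * b₀))))
    (hθu : θu = 4 * ((36 * (d : ℝ) * (frameC d L + d) ^ 2) * ((L : ℝ) ^ (j + 1)) ^ 2 * (cRE * b₀)))
    (hαE40 : αE ≤ 1 / 40) (hθu160 : θu ≤ 1 / 160)
    {δ : ℝ} (hδ : δ = corrC d / (L : ℝ) ^ (j + 1) * (2 * θu)) (hδ40 : δ ≤ 1 / 40) (hα₀ : αE + δ + 4 * (2 * θu + δ) * (αE + δ) ≤ α₀)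
    -- the remaining analytic letters at `W`: (L1)′ and α₁ for the SAME-TOP structured fields of radius `α₀`, (L2), (L3) discharged
    -- (L1)′ DISCHARGED (F111): the quadratic-remainder regime, the slice `S` containing the `W`-tangent skew periodic fields, and the names `c_N = 4m`, `ν = 24·#Plane·m`
    (hs1 : LevelSmall d L (j + 1) x) (hA : curvSum d L (j + 1) x ≤ 2 / 3 * L) (hσ0 : 4 * (3 + 12 * (d : ℝ)) ^ 2 * (L : ℝ) ^ (j + 1) * α₀ ≤ rho0 d L ^ 2)
    {cN aN ν : ℝ}
    (haN : aN = (supC d L / ((L : ℝ) ^ (j + 1) * (1 - cruxC d L * (((L : ℝ) ^ (j + 1)) ^ 2 * x)))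
        * (4 * (3 + 12 * (d : ℝ)) ^ 3 / rho0 d L ^ 2 * ((L : ℝ) ^ (j + 1) * α₀) ^ 2)))
    (hcN : cN = 4 * (supC d L / ((L : ℝ) ^ (j + 1) * (1 - cruxC d L * (((L : ℝ) ^ (j + 1)) ^ 2 * x)))
        * (4 * (3 + 12 * (d : ℝ)) ^ 3 / rho0 d L ^ 2 * ((L : ℝ) ^ (j + 1) * α₀) ^ 2)))
    (hνm : ν = 24 * (Fintype.card (T4AveragingDeficitWall.Plane d) : ℝ) * (supC d L / ((L : ℝ) ^ (j + 1) * (1 - cruxC d L * (((L : ℝ) ^ (j + 1)) ^ 2 * x)))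
        * (4 * (3 + 12 * (d : ℝ)) ^ 3 / rho0 d L ^ 2 * ((L : ℝ) ^ (j + 1) * α₀) ^ 2)))
    -- `x ≤ 1/4` (F141's regime; implied by `hbx'` when `d ≥ 2`, kept displayed for a one-line discharge)
    (hx4 : x ≤ 1 / 4)
    -- (KL-B): THE ONE-TERM LETTER ON BAŁABAN's STRAIGHT SLICE `ker QbarIter_W` IN THE BLOCK-LANDAU GAUGE (`hsR`-orthogonality to `gaugeDir W N(Q′(W))`)
    {KB : ℝ}
    (hB : ∀ X'' : Site d → Fin d → Matrix n n ℂ, IsSkewDir X'' → IsPeriodicDir X'' ((N * L ^ (j + 1) : ℕ) : ℤ) → QbarIter L (j + 1) W X'' = 0 →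
      (∀ nu ∈ avgKernelGauges (d := d) (n := n) L N (j + 1) W,
        ∑ y ∈ periodBox (d := d) (N * L ^ (j + 1)), ∑ κ : Fin d, hsR (X'' y κ) (gaugeDir W nu y κ) = 0) →
      ∀ g'' : ℝ, 0 ≤ g'' →
      (∀ Y : Site d → Fin d → Matrix n n ℂ, IsSkewDir Y → IsPeriodicDir Y ((N * L ^ (j + 1) : ℕ) : ℤ) → QbarIter L (j + 1) W Y = 0 →
        |hess W X'' Y (perWin d (N * L ^ (j + 1)))| ≤ g'' * dirL1 Y (periodBox (d := d) (N * L ^ (j + 1)))) →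
      ∀ z μ' ν', μ' ≠ ν' → ‖curlAt W X'' z μ' ν'‖ ≤ KB * g'')
    -- (R-H): the HARMONIC EXTENSION of prescribed nested block means (sup row `C_H` of Bałaban's scalar minimal extension at `W`)
    {CH Cb : ℝ}
    (hRH : ∀ θ' : Site d → Matrix n n ℂ, (∀ z, θ' z ∈ skewAdjoint (Matrix n n ℂ)) → (∀ (z : Site d) (i : Fin d), θ' (z + (N : ℤ) • e i) = θ' z) →
      ∀ s : ℝ, (∀ z, ‖θ' z‖ ≤ s) →
      ∃ h : Site d → Matrix n n ℂ, (∀ y, h y ∈ skewAdjoint (Matrix n n ℂ)) ∧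
        (∀ (y : Site d) (i : Fin d), h (y + ((N * L ^ (j + 1) : ℕ) : ℤ) • e i) = h y) ∧
        bmeanIterW L (j + 1) W h = θ' ∧
        (∀ nu ∈ avgKernelGauges (d := d) (n := n) L N (j + 1) W,
          ∑ y ∈ periodBox (d := d) (N * L ^ (j + 1)), ∑ κ : Fin d, hsR (gaugeDir W h y κ) (gaugeDir W nu y κ) = 0) ∧
        (∀ y, ‖h y‖ ≤ CH * s))
    -- (R-C): the BLOCK-LANDAU CORRECTION by a block-mean-zero gauge (sup row `C_b` of the block-mean-zero constrained scalar propagator at `W`; existence = F172)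
    (hRC : ∀ Z : Site d → Fin d → Matrix n n ℂ, IsSkewDir Z → IsPeriodicDir Z ((N * L ^ (j + 1) : ℕ) : ℤ) →
      ∀ D' : ℝ, (∀ y, ‖covDiv W Z y‖ ≤ D') →
      ∃ c ∈ avgKernelGauges (d := d) (n := n) L N (j + 1) W,
        (∀ nu ∈ avgKernelGauges (d := d) (n := n) L N (j + 1) W,
          ∑ y ∈ periodBox (d := d) (N * L ^ (j + 1)), ∑ κ : Fin d, hsR (Z y κ + gaugeDir W c y κ) (gaugeDir W nu y κ) = 0) ∧
        ∀ y, ‖c y‖ ≤ Cb * D')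
    (hcritW : ∀ Y : Site d → Fin d → Matrix n n ℂ, IsSkewDir Y → IsPeriodicDir Y ((N * L ^ (j + 1) : ℕ) : ℤ) → dirIter L (j + 1) W Y = 0 →
      dAction W Y (perWin d (N * L ^ (j + 1))) = 0) :
    SmallField U (x + ((KB * (1 + 2 * d * (2 * ((d : ℝ) * L) * Real.exp (((L : ℝ) ^ d / L) * ((d : ℝ) * (16 * ((d : ℝ) + 1) * ((d : ℝ) + 4) * (L : ℝ) ^ 2) * (1250 * ((nbRad d L : ℝ) + L) + 8 * ((d : ℝ) * L) + 2 * L)) * (2 / twoLevelSmall d L))))) * (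
        ((x + 4 * (Real.exp α₀ - 1))
            * ((curl1C d L / (1 - thetaLoc d L * (((L : ℝ) ^ (j + 1)) ^ 2 * (x + 4 * (Real.exp α₀ - 1)))))
                * (((L : ℝ) ^ (j + 1)) ^ d / ((L : ℝ) ^ (j + 1)) ^ 2))
            * (Real.exp (((L : ℝ) ^ d / L) * ((d : ℝ) * (16 * ((d : ℝ) + 1) * ((d : ℝ) + 4) * (L : ℝ) ^ 2)
                  * (1250 * ((nbRad d L : ℝ) + L) + 8 * ((d : ℝ) * L) + 2 * L)) * (2 / twoLevelSmall d L))
                * ((L : ℝ) / (L : ℝ) ^ d) ^ j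
                * (((d : ℝ) * (2 * nbRad d L + 1) ^ d) * ((2 * (d : ℝ) + 4) * (L : ℝ) ^ 2) * (2 * (L : ℝ) ^ j) * (Real.exp α₀ - 1)
                  + (17 / 8 * ((L : ℝ) ^ 2) ^ j * (x + 4 * (Real.exp α₀ - 1)))
                    * (((d : ℝ) * (2 * nbRad d L + 1) ^ d) * ((2 * (d : ℝ) + 4)
                          * (2 * (2 * L * (nbRad d L : ℝ) + 128 * ((d : ℝ) + 1) * ((d : ℝ) + 4) * (L : ℝ) ^ 2)))
                      + ((d : ℝ) * (2 * nbRad d L + 1) ^ d) * ((2 * (d : ℝ) + 4) * (L : ℝ) ^ 2 * (2 * (nbRad d L : ℝ))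
                          + 2 * (8 * (L : ℝ) + (1250 * ((nbRad d L : ℝ) + L) + 8 * (d * L) + 2 * L))
                              * (16 * ((d : ℝ) + 1) * ((d : ℝ) + 4) * (L : ℝ) ^ 2))))))
        + (Fintype.card (T4AveragingDeficitWall.Plane d) : ℝ)
          * (2 * (240 * (Real.exp α₀ - 1) * α₀ * (2 * ((4 * ((d : ℝ) * αE / ((L ^ (j + 1) : ℕ) : ℝ) + ((L ^ (j + 1) : ℕ) : ℝ) * ((((d : ℝ) - 1) * (2 * gU) + ((d : ℝ) - 1) * (2 * gW) + d * (2 * (Real.exp αE - 1) * xU + 2 * (xU * x) + 2 * (x * (2 + x) * x) + 2 * (xU * (2 + xU) * xU))) + 2 * (b₀ + 3 * (cRE * b₀)))) + (4 * ((L ^ (j + 1) : ℕ) : ℝ) * (8 * d * (Real.exp (4 * αE) - 1) * x + 10 * d * x + 2 * (2 * (d : ℝ) ^ 2 * (((L ^ (j + 1) : ℕ) : ℝ) + 1) * (2 * gW) + 8 * (d : ℝ) ^ 3 * (((L ^ (j + 1) : ℕ) : ℝ) + 1) ^ 2 * x ^ 2) + 12 * d * (2 * (d : ℝ) * (((L ^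 (j + 1) : ℕ) : ℝ) + 1) * x) ^ 2) + 4 * (2 * (d : ℝ) * (((L ^ (j + 1) : ℕ) : ℝ) + 1) * x)) * αE + 2 * x * αE) + 2 * δ + 2 * (4 * (2 * θu + δ) * (αE + δ))) + 24 * α₀ * (Real.exp α₀ - 1) + x) + 8 * α₀ * (2 * ((4 * ((d : ℝ) * αE / ((L ^ (j + 1) : ℕ) : ℝ) + ((L ^ (j + 1) : ℕ) : ℝ) * ((((d : ℝ) - 1) * (2 * gU) + ((d : ℝ) - 1) * (2 * gW) + d * (2 * (Real.exp αE - 1) * xU + 2 * (xU * x) + 2 * (x * (2 + x) * x) + 2 * (xU * (2 + xU) * xU))) + 2 * (b₀ + 3 * (cRE * b₀)))) + (4 * ((L ^ (j + 1) : ℕ) : ℝ) * (8 * d * (Real.exp (4 * αE) - 1) * x + 10 * d * x + 2 * (2 * (d : ℝ) ^ 2 * (((L ^ (j + 1) : ℕ) : ℝ) + 1) * (2 * gW) + 8 * (d : ℝ) ^ 3 * (((L ^ (j + 1) : ℕ) : ℝ) + 1) ^ 2 * x ^ 2) + 12 * d * (2 * (d : ℝ) * (((L ^ (j + 1) : ℕ)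 : ℝ) + 1) * x) ^ 2) + 4 * (2 * (d : ℝ) * (((L ^ (j + 1) : ℕ) : ℝ) + 1) * x)) * αE + 2 * x * αE) + 2 * δ + 2 * (4 * (2 * θu + δ) * (αE + δ))) + 24 * α₀ * (Real.exp α₀ - 1))
              + 6 * (Real.exp α₀ - 1) * (2 * ((4 * ((d : ℝ) * αE / ((L ^ (j + 1) : ℕ) : ℝ) + ((L ^ (j + 1) : ℕ) : ℝ) * ((((d : ℝ) - 1) * (2 * gU) + ((d : ℝ) - 1) * (2 * gW) + d * (2 * (Real.exp αE - 1) * xU + 2 * (xU * x) + 2 * (x * (2 + x) * x) + 2 * (xU * (2 + xU) * xU))) + 2 * (b₀ + 3 * (cRE * b₀)))) + (4 * ((L ^ (j + 1) : ℕ) : ℝ) * (8 * d * (Real.exp (4 * αE) - 1) * x + 10 * d * x + 2 * (2 * (d : ℝ) ^ 2 * (((L ^ (j + 1) : ℕ) : ℝ) + 1) * (2 * gW) + 8 * (d : ℝ) ^ 3 * (((L ^ (j + 1) : ℕ) : ℝ) + 1) ^ 2 * x ^ 2) + 12 * d * (2 * (d : ℝ) * (((L ^ (j + 1) : ℕ)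 : ℝ) + 1) * x) ^ 2) + 4 * (2 * (d : ℝ) * (((L ^ (j + 1) : ℕ) : ℝ) + 1) * x)) * αE + 2 * x * αE) + 2 * δ + 2 * (4 * (2 * θu + δ) * (αE + δ))) + 24 * (Real.exp α₀ - 1) * α₀)
              + (2 * ((4 * ((d : ℝ) * αE / ((L ^ (j + 1) : ℕ) : ℝ) + ((L ^ (j + 1) : ℕ) : ℝ) * ((((d : ℝ) - 1) * (2 * gU) + ((d : ℝ) - 1) * (2 * gW) + d * (2 * (Real.exp αE - 1) * xU + 2 * (xU * x) + 2 * (x * (2 + x) * x) + 2 * (xU * (2 + xU) * xU))) + 2 * (b₀ + 3 * (cRE * b₀)))) + (4 * ((L ^ (j + 1) : ℕ) : ℝ) * (8 * d * (Real.exp (4 * αE) - 1) * x + 10 * d * x + 2 * (2 * (d : ℝ) ^ 2 * (((L ^ (j + 1) : ℕ) : ℝ) + 1) * (2 * gW) + 8 * (d : ℝ) ^ 3 * (((L ^ (j + 1) : ℕ) : ℝ) + 1) ^ 2 * x ^ 2) + 12 * d * (2 * (d : ℝ) * (((L ^ (j + 1) : ℕ) : ℝ) + 1) * x) ^ 2)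 + 4 * (2 * (d : ℝ) * (((L ^ (j + 1) : ℕ) : ℝ) + 1) * x)) * αE + 2 * x * αE) + 2 * δ + 2 * (4 * (2 * θu + δ) * (αE + δ))) + 24 * (Real.exp α₀ - 1) * α₀) * (2 * ((4 * ((d : ℝ) * αE / ((L ^ (j + 1) : ℕ) : ℝ) + ((L ^ (j + 1) : ℕ) : ℝ) * ((((d : ℝ) - 1) * (2 * gU) + ((d : ℝ) - 1) * (2 * gW) + d * (2 * (Real.exp αE - 1) * xU + 2 * (xU * x) + 2 * (x * (2 + x) * x) + 2 * (xU * (2 + xU) * xU))) + 2 * (b₀ + 3 * (cRE * b₀)))) + (4 * ((L ^ (j + 1) : ℕ) : ℝ) * (8 * d * (Real.exp (4 * αE) - 1) * x + 10 * d * x + 2 * (2 * (d : ℝ) ^ 2 * (((L ^ (j + 1) : ℕ) : ℝ) + 1) * (2 * gW) + 8 * (d : ℝ) ^ 3 * (((L ^ (j + 1) : ℕ) : ℝ) + 1) ^ 2 * x ^ 2) + 12 * d * (2 * (d : ℝ) * (((L ^ (j + 1) : ℕ) : ℝ) + 1) * x) ^ 2) + 4 * (2 * (d : ℝ) * (((L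 ^ (j + 1) : ℕ) : ℝ) + 1) * x)) * αE + 2 * x * αE) + 2 * δ + 2 * (4 * (2 * θu + δ) * (αE + δ))) + 24 * α₀ * (Real.exp α₀ - 1))
              + 960 * (Real.exp α₀ - 1) * α₀ ^ 2 + 32 * x * α₀ ^ 2)
            + (64 * α₀ * ((4 * ((d : ℝ) * αE / ((L ^ (j + 1) : ℕ) : ℝ) + ((L ^ (j + 1) : ℕ) : ℝ) * ((((d : ℝ) - 1) * (2 * gU) + ((d : ℝ) - 1) * (2 * gW) + d * (2 * (Real.exp αE - 1) * xU + 2 * (xU * x) + 2 * (x * (2 + x) * x) + 2 * (xU * (2 + xU) * xU))) + 2 * (b₀ + 3 * (cRE * b₀)))) + (4 * ((L ^ (j + 1) : ℕ) : ℝ) * (8 * d * (Real.exp (4 * αE) - 1) * x + 10 * d * x + 2 * (2 * (d : ℝ) ^ 2 * (((L ^ (j + 1) : ℕ) : ℝ) + 1) * (2 * gW) + 8 * (d : ℝ) ^ 3 * (((L ^ (j + 1) : ℕ) : ℝ) + 1) ^ 2 * x ^ 2) + 12 * d * (2 * (d : ℝ) * (((L ^ (j + 1) : ℕ) : ℝ)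 + 1) * x) ^ 2) + 4 * (2 * (d : ℝ) * (((L ^ (j + 1) : ℕ) : ℝ) + 1) * x)) * αE + 2 * x * αE) + 2 * δ + 2 * (4 * (2 * θu + δ) * (αE + δ))) + 1024 * x * α₀ ^ 2))
        + ν) + (2 * d * KB * (2 * ((d : ℝ) * L) * Real.exp (((L : ℝ) ^ d / L) * ((d : ℝ) * (16 * ((d : ℝ) + 1) * ((d : ℝ) + 4) * (L : ℝ) ^ 2) * (1250 * ((nbRad d L : ℝ) + L) + 8 * ((d : ℝ) * L) + 2 * L)) * (2 / twoLevelSmall d L))) * ((d : ℝ) * gW + 12 * (Fintype.card (T4AveragingDeficitWall.Plane d) : ℝ) * x ^ 2)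
              + (2 * KB * ((d : ℝ) * gW + 12 * (Fintype.card (T4AveragingDeficitWall.Plane d) : ℝ) * x ^ 2) * (1 + 4 * d * (2 * ((d : ℝ) * L) * Real.exp (((L : ℝ) ^ d / L) * ((d : ℝ) * (16 * ((d : ℝ) + 1) * ((d : ℝ) + 4) * (L : ℝ) ^ 2) * (1250 * ((nbRad d L : ℝ) + L) + 8 * ((d : ℝ) * L) + 2 * L)) * (2 / twoLevelSmall d L)))) + 2 * x) * (CH * (6 * (d : ℝ) * (L : ℝ) ^ (j + 1)))) * (α₀ + aN)
        + ((2 * KB * ((d : ℝ) * gW + 12 * (Fintype.card (T4AveragingDeficitWall.Plane d) : ℝ) * x ^ 2) * (1 + 4 * d * (2 * ((d : ℝ) * L) * Real.exp (((L : ℝ) ^ d / L) * ((d : ℝ) * (16 * ((d : ℝ) + 1) * ((d : ℝ) + 4) * (L : ℝ) ^ 2) * (1250 * ((nbRad d L : ℝ) + L) + 8 * ((d : ℝ) * L) + 2 * L)) * (2 / twoLevelSmall d L)))) + 2 * x) * Cb) * (2 * (d : ℝ) * (4 * (2 * θu + δ) * (αE + δ)) + (b₀ + 3 * (cRE * b₀))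 + 2 * (d : ℝ) * aN) 
        + ((2 * KB * ((d : ℝ) * gW + 12 * (Fintype.card (T4AveragingDeficitWall.Plane d) : ℝ) * x ^ 2) * (1 + 4 * d * (2 * ((d : ℝ) * L) * Real.exp (((L : ℝ) ^ d / L) * ((d : ℝ) * (16 * ((d : ℝ) + 1) * ((d : ℝ) + 4) * (L : ℝ) ^ 2) * (1250 * ((nbRad d L : ℝ) + L) + 8 * ((d : ℝ) * L) + 2 * L)) * (2 / twoLevelSmall d L)))) + 2 * x) * (1 + CH)) * (2 * θu) + cN + 28 * α₀ ^ 2)) := by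
  exact smallField_of_tanCritical_roadB_balaban_end hd hL j hWu hWP hx hs hWx hα0 hs' hθ hθl hε hUu hUP hxU hsU hUxU hcritU hTopUW hgW hgU hbx hcx hbx' hcx'
    hr₀ hb₀ hcRE hreg₁ hreg₂ hreg₃ hline hαE hθu hαE40 hθu160 hδ hδ40 hα₀ hs1 hA hσ0 haN hcN hνm hx4
    (fun X'' => ∀ nu ∈ avgKernelGauges (d := d) (n := n) L N (j + 1) W,
      ∑ y ∈ periodBox (d := d) (N * L ^ (j + 1)), ∑ κ : Fin d, hsR (X'' y κ) (gaugeDir W nu y κ) = 0) hB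
    (transportLetter_blockLandau_of_rows (by omega) hL j hWu hWP hx hs hWx hA hRH hRC) hcritW

end

end Summit.QuantumFields.BalabanUV.T4Continuum.NE7ApeCurvedRepRoadBBlockLandauEnd
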